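import Summits.CriticalPhenomena.Ising3DConformalLimit.Theses.FKParityRobustness

/-!
# CriticalPhenomena / Ising3DConformalLimit — route FKParityRobustness, assembly

Settles item `stmt-CriticalPhenomena-14624` (rank 1, assembly of route
`route-CriticalPhenomena-FKParityRobustness`, rev 4 spine):

`IndependentStrandsJoin → JoinForcesU4 → MoebiusLimit → Ising3DConformalLimit`.

Pure logic over the summit's structure predicates
(`Literature/Probability/LatticeModels/ScalingLimit3D.lean`): `MoebiusLimit` supplies
`ρ, Δ, S` together with positivity of `ρ` on `(0,1]`, `0 < Δ`, the pointwise scaling limit,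
non-degeneracy of the two-point function and Möbius covariance; the bridge `JoinForcesU4`
applied to the crux `IndependentStrandsJoin` and to `ρ, S` (positivity, limit, non-degeneracy)
gives `HasNontrivialU4 S`; the conjunct `Ising3DConformalLimit`
(= `CritIsing3DConformalLimit`) is the resulting 6-tuple. Same term as the route's deciding
theorem `closes`. No named facts are used; the theorem is unconditional bookkeeping.
-/

namespace Summit.CriticalPhenomena.Ising3DConformalLimit.Theorems

open Summit.CriticalPhenomena.Ising3DConformalLimit.Theses.FKParityRobustness
open Literature.Probability.LatticeModels

/-- Settles `stmt-CriticalPhenomena-14624` (exact signature): the assembly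
`IndependentStrandsJoin → JoinForcesU4 → MoebiusLimit → Ising3DConformalLimit` of route
FKParityRobustness. Proof: `ρ, Δ, S` and the limit / non-degeneracy / Möbius clauses from
`MoebiusLimit`; `JoinForcesU4 IndependentStrandsJoin ρ S` gives `HasNontrivialU4 S`; pack the
six clauses of `CritIsing3DConformalLimit`. [folklore] -/
theorem fkParityRobustness_assembly_proof :
    Summit.CriticalPhenomena.Ising3DConformalLimit.Theses.FKParityRobustness.Assembly := by
  unfold Assembly
  intro hK1 hJ hML
  obtain ⟨ρ, Δ, S, hρ, hΔ, hlim, hnd, hmob⟩ := hML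
  have hU4 : HasNontrivialU4 S := hJ hK1 ρ S hρ hlim hnd
  exact ⟨ρ, Δ, S, hρ, hΔ, hlim, hnd, hmob, hU4⟩

end Summit.CriticalPhenomena.Ising3DConformalLimit.Theorems
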